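import Literature.Probability.Percolation.Percolation
import Literature.Probability.LatticeModels.TriangularLattice
import HarnessLib

/-!
# Route CardyBondTriangular — item `BondTriangularBoxCrossing` (stmt-CriticalPhenomena-7023): definitions

Objects posited by the unconditional proof of the route item `BondTriangularBoxCrossing` — the
box-crossing (RSW) property of critical bond percolation on the triangular lattice `𝕋` — along
Grimmett–Manolescu's star–triangle transport (PTRF 159 (2014) = arXiv:1204.0505, §7, proof of
Thm 3.1 for general graphs, specialised to `𝕋`): the horizontal edges of `𝕋` in a slab of `N` rows
are pushed out through the top by finitely many star–triangle transformations, after which the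
slab is a box of an isoradial square lattice (for which the box-crossing property is the tree's
theorem `isoradialSquare_boxCrossing_lower_real`, GM14 Cor. 6.2).

* Layer A (any countable label type `V`): `conn A B` (some vertex of `A` is joined to some
  vertex of `B` by an open path), `pairsIn U`, `truncW U p` (weights restricted to the pairs
  inside `U`).
* Layer B (labels `pt b m = (b, m) ∈ ℤ²` of `𝕋`, rows `m`): the parameters `Cfg` of the sweep
  (levels `1 … N`, chains for the rows `1 … N − 1` at positions `lo − j … L`, label box
  `[lo − N − 2, L + 3] × [1, N]`), its states `St` = `(j, a, k)` (rows `> j` done, chains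
  `(j, a')`, `a' < a`, done, `k` steps of the chain `(j, a)` done), the predicate `DoneFace`
  ("the chain of row `r` through the up-face `(b, m)` has acted on it"), the flags `FlagV`,
  `FlagD` of the slanted slots, the travelling horizontal edge `Transient`, `AliveH`, and the
  **closed form of the weights** `weight C t σ : Sym2 (Site 2) → unitInterval` at every state
  (`wH`, `wV`, `wD` on the three edge families `h(b,m) = {(b,m),(b+1,m)}`,
  `v(b,m) = {(b,m),(b,m+1)}`, `d(b,m) = {(b+1,m),(b,m+1)}`, and `0` elsewhere); the standing
  hypotheses `StepHyp` of a step, the `spare` label, the row starts `St.start`, and the `Core` /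
  `CoreV` of the label box where the final weights are those of the square lattice.

Only definitions (and the symmetry lemma needed to define `weight` through `Sym2.lift`); all
theorems are in the companion files `CardyBondTriangularBondTriangularBoxCrossing*.lean`.

## References

* G. R. Grimmett, I. Manolescu, PTRF 159 (2014), arXiv:1204.0505, §5.1–5.3, §7.
-/

noncomputable section

namespace Summit.CriticalPhenomena.CardyFormulaZ2.Theorems.TriSweep

open Literature.Probability.LatticeModels Literature.Probability.Percolation

/-! ### Connection events and restricted weights (layer A) -/

section Conn

variable {V : Type*}

/-- The event that some `a ∈ A` is joined to some `b ∈ B` by an open path (no restriction on the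
path). [GM14 §7: the events `E_N` are of this kind once the weights are restricted to a slab.] -/
def conn (A B : Set V) : Set (BondConfig V) := ⋃ a ∈ A, ⋃ b ∈ B, openConn a b

/-- Membership in `conn A B`, unfolded. -/
theorem mem_conn_iff {A B : Set V} {ω : BondConfig V} :
    ω ∈ conn A B ↔ ∃ a ∈ A, ∃ b ∈ B, (openGraph ω).Reachable a b := by
  simp only [conn, Set.mem_iUnion, openConn, Set.mem_setOf_eq, exists_prop]

/-- The pairs with both endpoints in `U`. -/
def pairsIn (U : Set V) : Set (Sym2 V) := {e | ∀ x ∈ e, x ∈ U}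

/-- Membership of a pair in `pairsIn U`. -/
theorem mk_mem_pairsIn {U : Set V} {x y : V} : s(x, y) ∈ pairsIn U ↔ x ∈ U ∧ y ∈ U := by
  simp only [pairsIn, Set.mem_setOf_eq, Sym2.mem_iff, forall_eq_or_imp, forall_eq]

open Classical in
/-- The weights restricted to the pairs inside `U` (all other pairs get weight `0`). -/
def truncW (U : Set V) (p : Sym2 V → unitInterval) : Sym2 V → unitInterval :=
  fun e => if e ∈ pairsIn U then p e else 0

/-- Restricted weights on a pair inside `U`. -/
theorem truncW_of_mem {U : Set V} {p : Sym2 V → unitInterval} {e : Sym2 V} (h : e ∈ pairsIn U) :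
    truncW U p e = p e := by
  classical
  simp only [truncW, if_pos h]

/-- Restricted weights vanish on pairs not inside `U`. -/
theorem truncW_of_not_mem {U : Set V} {p : Sym2 V → unitInterval} {e : Sym2 V}
    (h : e ∉ pairsIn U) : truncW U p e = 0 := by
  classical
  simp only [truncW, if_neg h]

end Conn

/-! ### Labels -/

/-- The label `(b, m) ∈ ℤ²` (column `b`, row `m`) as a site of `𝕋`. -/
def pt (b m : ℤ) : Site 2 := ![b, m]

/-- Coordinates of `pt`. -/
@[simp] theorem pt_zero (b m : ℤ) : pt b m 0 = b := rfl

/-- Coordinates of `pt`. -/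
@[simp] theorem pt_one (b m : ℤ) : pt b m 1 = m := rfl

/-- Every site is a `pt`. -/
theorem pt_eta (x : Site 2) : pt (x 0) (x 1) = x := by
  ext i; fin_cases i <;> rfl

/-- `pt` is injective. -/
theorem pt_inj {b m b' m' : ℤ} : pt b m = pt b' m' ↔ b = b' ∧ m = m' := by
  constructor
  · intro h
    exact ⟨by simpa using congrFun h 0, by simpa using congrFun h 1⟩
  · rintro ⟨rfl, rfl⟩; rfl

/-! ### The parameters and the states of the sweep -/

/-- The parameters of the sweep: `N` levels (rows `1 … N`), chains for the rows `1 … N − 1` at the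
positions `lo − j … L`; the weights live on the label box `[lo − N − 2, L + 3] × [1, N]`. -/
structure Cfg where
  /-- number of levels -/
  N : ℤ
  /-- left end of the positions of the chains of row `0` (row `j` starts at `lo − j`) -/
  lo : ℤ
  /-- right end of the positions of the chains -/
  L : ℤ

namespace Cfg

variable (C : Cfg)

/-- Left end of the label box. -/
def Blo : ℤ := C.lo - C.N - 2

/-- Right end of the label box. -/
def Bhi : ℤ := C.L + 3

/-- The vertex `(b, m)` lies in the label box. -/
def InBox (b m : ℤ) : Prop := 1 ≤ m ∧ m ≤ C.N ∧ C.Blo ≤ b ∧ b ≤ C.Bhi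

end Cfg

/-- A state of the sweep: all chains of the rows `> j` are done, the chains `(j, a')` with
`a' < a` are done, and the first `k` steps of the chain `(j, a)` are done. -/
structure St where
  /-- current row -/
  j : ℤ
  /-- current position -/
  a : ℤ
  /-- number of steps of the current chain already performed -/
  k : ℤ

/-- The state after one more step of the current chain. -/
def St.succ (σ : St) : St := ⟨σ.j, σ.a, σ.k + 1⟩

variable (C : Cfg)

/-- **`DoneFace C σ b m r`**: at the state `σ`, the chain of row `r` through the up-face `(b, m)`
— it is the chain `(r, b + i)` with `r + 2i = m`, acting on this face at its `i`-th step — exists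
(`1 ≤ r`, `m ≤ N − 1`, `lo − r ≤ b + i ≤ L`) and has already performed that step. -/
def DoneFace (σ : St) (b m r : ℤ) : Prop :=
  ∃ i : ℤ, 0 ≤ i ∧ r + 2 * i = m ∧ 1 ≤ r ∧ m ≤ C.N - 1 ∧ C.lo - r ≤ b + i ∧ b + i ≤ C.L ∧
    (σ.j < r ∨ (r = σ.j ∧ (b + i < σ.a ∨ (b + i = σ.a ∧ i < σ.k))))

/-- The flag of the edge `v(b, m)`: its last modification was by a double/half step at the face
`(b, m)` (which sets it to `1 − t`) rather than by a double step at the face `(b, m − 1)` (which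
sets it back to `t`); these alternate, row by row. -/
def FlagV (σ : St) (b m : ℤ) : Prop :=
  ∃ r, DoneFace C σ b m r ∧ ¬ DoneFace C σ b (m - 1) (r - 1)

/-- The flag of the edge `d(b, m)`: set to `1 − t` by the steps at the face `(b, m)`, back to `t`
by the double steps at the face `(b + 1, m − 1)`. -/
def FlagD (σ : St) (b m : ℤ) : Prop :=
  ∃ r, DoneFace C σ b m r ∧ ¬ DoneFace C σ (b + 1) (m - 1) (r - 1)

/-- The travelling horizontal edge of the current chain sits at the slot `h(b, m)`. -/
def Transient (σ : St) (b m : ℤ) : Prop := 1 ≤ σ.k ∧ b = σ.a - σ.k ∧ m = σ.j + 2 * σ.k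

/-- The horizontal slot `h(b, m)` carries an edge: either the original edge of `𝕋` not yet
removed by the chain `(m, b)` (levels `≤ N − 1` only), or the travelling edge. -/
def AliveH (σ : St) (b m : ℤ) : Prop := (m ≤ C.N - 1 ∧ ¬ DoneFace C σ b m m) ∨ Transient σ b m

section Weights

variable (t : unitInterval)

open Classical in
/-- Weight of the horizontal slot `h(b, m) = {(b,m), (b+1,m)}`. -/
def wH (σ : St) (b m : ℤ) : unitInterval :=
  if C.InBox b m ∧ C.InBox (b + 1) m ∧ AliveH C σ b m then t else 0

open Classical in
/-- Weight of the slot `v(b, m) = {(b,m), (b,m+1)}`. -/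
def wV (σ : St) (b m : ℤ) : unitInterval :=
  if C.InBox b m ∧ C.InBox b (m + 1) then (if FlagV C σ b m then unitInterval.symm t else t)
  else 0

open Classical in
/-- Weight of the slot `d(b, m) = {(b+1,m), (b,m+1)}`. -/
def wD (σ : St) (b m : ℤ) : unitInterval :=
  if C.InBox (b + 1) m ∧ C.InBox b (m + 1) then (if FlagD C σ b m then unitInterval.symm t else t)
  else 0

open Classical in
/-- The weight of the pair `{P, Q}` at the state `σ`, as a function of the two endpoints. -/
def wPair (σ : St) (P Q : Site 2) : unitInterval :=
  if Q 0 = P 0 + 1 ∧ Q 1 = P 1 then wH C t σ (P 0) (P 1)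
  else if P 0 = Q 0 + 1 ∧ P 1 = Q 1 then wH C t σ (Q 0) (Q 1)
  else if Q 0 = P 0 ∧ Q 1 = P 1 + 1 then wV C t σ (P 0) (P 1)
  else if P 0 = Q 0 ∧ P 1 = Q 1 + 1 then wV C t σ (Q 0) (Q 1)
  else if P 0 = Q 0 + 1 ∧ Q 1 = P 1 + 1 then wD C t σ (Q 0) (P 1)
  else if Q 0 = P 0 + 1 ∧ P 1 = Q 1 + 1 then wD C t σ (P 0) (Q 1)
  else 0

/-- `wPair` is symmetric. -/
theorem wPair_symm (σ : St) (P Q : Site 2) : wPair C t σ P Q = wPair C t σ Q P := by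
  unfold wPair
  split_ifs <;> first | rfl | omega

/-- **The weights at the state `σ`.** -/
def weight (σ : St) : Sym2 (Site 2) → unitInterval :=
  Sym2.lift ⟨wPair C t σ, wPair_symm C t σ⟩

/-- The weight of a pair, unfolded. -/
theorem weight_mk (σ : St) (P Q : Site 2) : weight C t σ s(P, Q) = wPair C t σ P Q := rfl

end Weights

section StepHypDef

/-- The standing hypotheses on the current state: the chain `(j, a)` is one of the chains of the
sweep (`1 ≤ j ≤ N − 1`, `lo − j ≤ a ≤ L`) and `k ≥ 0` steps of it have been performed. -/
structure StepHyp (C : Cfg) (σ : St) : Prop where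
  /-- the row is at least `1` -/
  j_pos : 1 ≤ σ.j
  /-- the row is at most `N − 1` -/
  j_lt : σ.j + 1 ≤ C.N
  /-- the position is at least `lo − j` -/
  lo_le : C.lo - σ.j ≤ σ.a
  /-- the position is at most `L` -/
  le_L : σ.a ≤ C.L
  /-- the step count is nonnegative -/
  k_nonneg : 0 ≤ σ.k

end StepHypDef

/-- The spare label, outside the label box. -/
def spare : Site 2 := pt (C.L + 10) 1

/-- The state at the beginning of the row `j` (nothing of the rows `≤ j` done). -/
def St.start (j : ℤ) : St := ⟨j, C.lo - j, 0⟩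

/-- **The core** of the label box: the faces whose whole history of chains exists
(`2 lo + 2 ≤ 2b + m ≤ 2L`, a vertical strip in the Euclidean picture). -/
def Core (C : Cfg) (b m : ℤ) : Prop := 2 * C.lo + 2 ≤ 2 * b + m ∧ 2 * b + m ≤ 2 * C.L

/-- The vertices all of whose edge slots belong to faces of the core. -/
def CoreV (C : Cfg) (b m : ℤ) : Prop := 2 * C.lo + 4 ≤ 2 * b + m ∧ 2 * b + m ≤ 2 * C.L


/-! ### The relabelling onto the square lattice (layer C) -/

/-- The label `(b, m)` of the swept slab corresponds to the vertex `(b + m − 1, −b)` of the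
square lattice `ℤ²` (diamond coordinates of `LatticeWalksGM`: height `m − 1`, column
`2b + m − 1`); this is the bijection. -/
def relab : Site 2 ≃ Site 2 where
  toFun x := pt (x 0 + x 1 - 1) (-x 0)
  invFun y := pt (-y 1) (y 0 + y 1 + 1)
  left_inv x := by
    ext i; fin_cases i
    · simp [pt]
    · simp only [pt, Fin.mk_one, Fin.isValue, Matrix.cons_val_one, Matrix.cons_val_fin_one,
        Matrix.cons_val_zero]; ring
  right_inv y := by
    ext i; fin_cases i
    · simp only [pt, Fin.zero_eta, Fin.isValue, Matrix.cons_val_zero, Matrix.cons_val_one,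
        Matrix.cons_val_fin_one]; ring
    · simp [pt]

/-- Column angles of the target isoradial square lattice `G_{α,β}`: `0` on the even columns,
`π/3` on the odd ones. -/
def alphaT (c : ℤ) : ℝ := if Even c then 0 else Real.pi / 3

/-- Row angles of the target isoradial square lattice: constant `2π/3` (so the rhombus angles
`β_j − α_i` are `2π/3` and `π/3`, whose canonical weights are `1 − p₀` and `p₀ = 2 sin(π/18)`). -/
def betaT (_ : ℤ) : ℝ := 2 * Real.pi / 3

end Summit.CriticalPhenomena.CardyFormulaZ2.Theorems.TriSweep

end
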